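import Mathlib
import Summits.ValiantsHypothesis.ValiantsHypothesis.Theorems.RigidityForcesSymmetryRankRigidMinimalReprLaplaceFourDefs
import Summits.ValiantsHypothesis.ValiantsHypothesis.Theorems.RigidityForcesSymmetryRankRigidMinimalReprLaplaceFourContraction
import Summits.ValiantsHypothesis.ValiantsHypothesis.Theorems.RigidityForcesSymmetryRankRigidMinimalReprLaplaceFourEasy
import Summits.ValiantsHypothesis.ValiantsHypothesis.Theorems.RigidityForcesSymmetryRankRigidMinimalReprLaplaceFourLineCore
import Summits.ValiantsHypothesis.ValiantsHypothesis.Theorems.RigidityForcesSymmetryRankRigidMinimalReprLaplaceFourLineKills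

/-!
# LINE profiles `(3,2,0)`, `slice+(2,2,0)`, `slice+(3,1,0)` of `LaplaceOptimal 4` are impossible
# (crux `RankRigidMinimalRepr`, stmt-ValiantsHypothesis-18034, route `RigidityForcesSymmetry`)

Three of the five LINE profiles of the exact analysis of `LaplaceOptimal 4`, in canonical position: at most three
noise terms (`S_t ∈ {{0}, {0,1}}`) and at most two rank-one terms whose contracted COLUMN is linear in `ψ` or constant
(`S_t ∈ {{0,2}, {2}}`) — this covers `(3,2,0)` = `{01|23}³{02|13}²`, `slice₀ + {01|23}²{02|13}²`, and (after the slot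
relabelling `(02)(13)`) `slice₀ + {01|23}³{02|13}` = `{01|23}³{02|13}{slice₂}`.

`line_profile_psi`: such a decomposition of `P₄` does not exist.  Stage A (`line_core`) gives a line family
`lineVec d` annihilating the noise; a letter relabelling (`letterPerm`, `exists_perm_zero_one`) makes `d` the star at `0`
or the matching `(0,1)`; along these the columns of the two rank-one terms are affine in `φ` (resp. in `φ₀, φ₁`), and
`star_kill` / `matching_kill` (`…LaplaceFourLineKills.lean`) finish.

HONEST FRAMING: three finite profiles of `LaplaceOptimal 4` (rung `TiedTorusBound 3`); the crux stays OPEN; nothing here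
bears on `VP ≠ VNP`.
-/

set_option autoImplicit false

-- the mandated summit-side namespace repeats a component by design (single-problem summit)
set_option linter.dupNamespace false

namespace Summit.ValiantsHypothesis.ValiantsHypothesis.Theorems.RigidityForcesSymmetryRankRigidMinimalRepr

namespace LaplaceFourLine

open Matrix LaplaceFourContraction LaplaceFourEasy

/-! ### §1 Small tools -/

/-- A letter relabelling sending `0 ↦ i`, `1 ↦ j`. -/
theorem exists_perm_zero_one : ∀ i j : Fin 4, i ≠ j → ∃ π : Equiv.Perm (Fin 4), π 0 = i ∧ π 1 = j := by
  decide

/-- Along the two canonical families, `lineVec d φ` is a sign/zero pattern times `φ`. -/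
theorem lineVec_canonical_diag (d : Fin 4 ⊕ (Fin 4 × Fin 4)) (hd : d = Sum.inl 0 ∨ d = Sum.inr (0, 1)) :
    ∃ σ : Fin 4 → ℂ, (∀ φ : Fin 4 → ℂ, ∀ x, lineVec d φ x = σ x * φ x) ∧
      (d = Sum.inr (0, 1) → σ 2 = 0 ∧ σ 3 = 0) := by
  rcases hd with rfl | rfl
  · exact ⟨![1, -1, -1, -1], fun φ x => by rw [lineVec_star]; fin_cases x <;> simp, fun h => by cases h⟩
  · exact ⟨![1, -1, 0, 0], fun φ x => by rw [lineVec_matching]; fin_cases x <;> simp, fun _ => by simp⟩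

/-- A rank-one term with `S ∈ {{0,2}, {2}}`: its contracted column is «constant + linear in `ψ`». -/
theorem psi_column_shape {X : (Fin 4 → Fin 4) → ℂ} {S : Finset (Fin 4)} (hX : IsSplitTerm S X)
    (hS : S = {0, 2} ∨ S = {2}) :
    ∃ (f : Fin 4 → ℂ) (b : Fin 4 → Fin 4 → ℂ), ∀ ψ φ : Fin 4 → ℂ, ∃ r : Fin 4 → ℂ,
      contract₀₁ X ψ φ = vecMulVec (fun k => f k + ∑ x, ψ x * b x k) r := by
  obtain ⟨u, w, hu, hw, hX'⟩ := hX
  rcases hS with rfl | rfl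
  · obtain ⟨b, b', hb⟩ := contract_term_02 hu hw
    refine ⟨0, b, fun ψ φ => ⟨fun j => ∑ y, φ y * b' y j, ?_⟩⟩
    rw [contract_congr hX', hb]
    congr 1; funext k; simp
  · obtain ⟨f, hf⟩ := contract_term_2 hu hw
    refine ⟨f, 0, fun ψ φ => ?_⟩
    obtain ⟨r, hr⟩ := hf ψ φ
    refine ⟨r, ?_⟩
    rw [contract_congr hX', hr]
    congr 1; funext k; simp

/-! ### §2 The canonical case -/

/-- The three ψ-type LINE profiles in canonical position, given the stage-A identity along the star at `0` or the
matching `(0,1)`: contradiction. -/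
theorem psi_canonical {ι : Type*} (T : Finset ι) (X : ι → (Fin 4 → Fin 4) → ℂ) (S : ι → Finset (Fin 4))
    (hX : ∀ t ∈ T, IsSplitTerm (S t) (X t))
    (hS : ∀ t ∈ T, S t = {0} ∨ S t = {0, 1} ∨ S t = {0, 2} ∨ S t = {2})
    (hsum : ∀ v, permPattern₄ v = ∑ t ∈ T, X t v)
    (hR : (T.filter fun t => ¬(S t = {0} ∨ S t = {0, 1})).card ≤ 2)
    (d : Fin 4 ⊕ (Fin 4 × Fin 4)) (hd : d = Sum.inl 0 ∨ d = Sum.inr (0, 1))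
    (hid : ∀ φ : Fin 4 → ℂ, ∑ t ∈ T.filter (fun t => S t = {0} ∨ S t = {0, 1}),
      contract₀₁ (X t) (lineVec d φ) φ = 0) : False := by
  classical
  set N := T.filter fun t => S t = {0} ∨ S t = {0, 1} with hNdef
  set R := T.filter fun t => ¬(S t = {0} ∨ S t = {0, 1}) with hRdef
  have hTNR : T = N ∪ R := by rw [hNdef, hRdef]; exact (Finset.filter_union_filter_not_eq _ T).symm
  have hdisj : Disjoint N R := by rw [hNdef, hRdef]; exact Finset.disjoint_filter_filter_not T T _
  -- column shapes of the rank-one terms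
  have hcol : ∀ t ∈ R, ∃ (f : Fin 4 → ℂ) (b : Fin 4 → Fin 4 → ℂ), ∀ ψ φ : Fin 4 → ℂ, ∃ r : Fin 4 → ℂ,
      contract₀₁ (X t) ψ φ = vecMulVec (fun k => f k + ∑ x, ψ x * b x k) r := by
    intro t ht
    rw [hRdef, Finset.mem_filter] at ht
    have := hS t ht.1
    exact psi_column_shape (hX t ht.1) (by tauto)
  choose! f b hfb using hcol
  choose! r hr using hfb
  obtain ⟨σ, hσ, hσ23⟩ := lineVec_canonical_diag d hd
  -- the identity `Q(ℓφ,φ) = Σ_R …`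
  have hQ : ∀ φ, contract₀₁ permPattern₄ (lineVec d φ) φ =
      ∑ t ∈ R, vecMulVec (fun k => f t k + ∑ x, (σ x * b t x k) * φ x) (r t (lineVec d φ) φ) := by
    intro φ
    rw [contract_congr hsum, contract_sum, hTNR, Finset.sum_union hdisj, hid φ, zero_add]
    refine Finset.sum_congr rfl fun t ht => ?_
    rw [hr t ht]
    congr 1; funext k; congr 1
    exact Finset.sum_congr rfl fun x _ => by rw [hσ φ x]; ring
  -- pad to exactly two terms
  have htwo : ∃ t₁ t₂ : ι, ∃ (f₁ f₂ : Fin 4 → ℂ) (b₁ b₂ : Fin 4 → Fin 4 → ℂ),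
      (b₁ = b t₁ ∨ b₁ = 0) ∧ (b₂ = b t₂ ∨ b₂ = 0) ∧
      ∀ φ, contract₀₁ permPattern₄ (lineVec d φ) φ =
        vecMulVec (fun k => f₁ k + ∑ x, (σ x * b₁ x k) * φ x) (r t₁ (lineVec d φ) φ) +
        vecMulVec (fun k => f₂ k + ∑ x, (σ x * b₂ x k) * φ x) (r t₂ (lineVec d φ) φ) := by
    have hz : ∀ (ρ : Fin 4 → ℂ), vecMulVec (fun k => (0 : Fin 4 → ℂ) k + ∑ x, (σ x * (0 : Fin 4 → Fin 4 → ℂ) x k) *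
        (0 : ℂ)) ρ = 0 := fun ρ => by ext i j; simp [vecMulVec_apply]
    rcases Nat.lt_or_ge R.card 1 with h0 | h1
    · have hR0 : R = ∅ := Finset.card_eq_zero.1 (by omega)
      have hT0 : ∀ φ, contract₀₁ permPattern₄ (lineVec d φ) φ = 0 := fun φ => by rw [hQ φ, hR0, Finset.sum_empty]
      -- impossible already: `Q(ℓφ, φ) ≠ 0` at `φ = 𝟙`; we still produce the padded form
      obtain ⟨t₀⟩ : Nonempty ι := by
        by_contra hι; rw [not_nonempty_iff] at hι
        have := hsum ![0, 1, 2, 3]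
        rw [Finset.eq_empty_of_isEmpty T, Finset.sum_empty, permPattern₄, if_pos] at this
        · exact one_ne_zero this
        · decide
      refine ⟨t₀, t₀, 0, 0, 0, 0, Or.inr rfl, Or.inr rfl, fun φ => ?_⟩
      rw [hT0]; ext i j; simp [vecMulVec_apply]
    rcases Nat.lt_or_ge R.card 2 with h1' | h2
    · obtain ⟨t₁, ht₁⟩ := Finset.card_eq_one.1 (show R.card = 1 by omega)
      refine ⟨t₁, t₁, f t₁, 0, b t₁, 0, Or.inl rfl, Or.inr rfl, fun φ => ?_⟩
      rw [hQ φ, ht₁, Finset.sum_singleton]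
      conv_lhs => rw [← add_zero (vecMulVec _ _)]
      congr 1; ext i j; simp [vecMulVec_apply]
    · obtain ⟨t₁, t₂, hne, ht⟩ := Finset.card_eq_two.1 (show R.card = 2 by omega)
      exact ⟨t₁, t₂, f t₁, f t₂, b t₁, b t₂, Or.inl rfl, Or.inl rfl, fun φ => by rw [hQ φ, ht, Finset.sum_pair hne]⟩
  obtain ⟨t₁, t₂, f₁, f₂, b₁, b₂, -, -, hM⟩ := htwo
  rcases hd with rfl | rfl
  · exact star_kill (fun φ k => f₁ k + ∑ x, (σ x * b₁ x k) * φ x) (fun φ k => f₂ k + ∑ x, (σ x * b₂ x k) * φ x)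
      (fun φ => r t₁ (lineVec (Sum.inl 0) φ) φ) (fun φ => r t₂ (lineVec (Sum.inl 0) φ) φ) f₁ f₂
      (fun x k => σ x * b₁ x k) (fun x k => σ x * b₂ x k) (fun _ _ => rfl) (fun _ _ => rfl) fun φ _ => hM φ
  · obtain ⟨h2, h3⟩ := hσ23 rfl
    exact matching_kill (fun φ k => f₁ k + ∑ x, (σ x * b₁ x k) * φ x) (fun φ k => f₂ k + ∑ x, (σ x * b₂ x k) * φ x)
      (fun φ => r t₁ (lineVec (Sum.inr (0, 1)) φ) φ) (fun φ => r t₂ (lineVec (Sum.inr (0, 1)) φ) φ) f₁ f₂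
      (fun x k => σ x * b₁ x k) (fun x k => σ x * b₂ x k) (fun _ _ => rfl) (fun _ _ => rfl)
      (fun k => by simp [h2, h3]) (fun k => by simp [h2, h3]) fun φ _ => hM φ

/-! ### §3 The three profiles -/

/-- **The ψ-type LINE profiles are impossible**: no split-rank-one decomposition of `P₄` in canonical position has at
most three noise terms `S_t ∈ {{0},{0,1}}`, at most two rank-one terms `S_t ∈ {{0,2},{2}}`, and nothing else.  This is
the exact content of the profiles `(3,2,0)`, `slice+(2,2,0)` and (relabelled) `slice+(3,1,0)` of `LaplaceOptimal 4`. -/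
theorem line_profile_psi {ι : Type*} (T : Finset ι) (X : ι → (Fin 4 → Fin 4) → ℂ) (S : ι → Finset (Fin 4))
    (hX : ∀ t ∈ T, IsSplitTerm (S t) (X t))
    (hS : ∀ t ∈ T, S t = {0} ∨ S t = {0, 1} ∨ S t = {0, 2} ∨ S t = {2})
    (hsum : ∀ v, permPattern₄ v = ∑ t ∈ T, X t v)
    (hN : (T.filter fun t => S t = {0} ∨ S t = {0, 1}).card ≤ 3)
    (hR : (T.filter fun t => ¬(S t = {0} ∨ S t = {0, 1})).card ≤ 2) : False := by
  classical
  obtain ⟨d, hdvalid, hid⟩ := line_core T X S hX (fun t ht => by have := hS t ht; tauto) hsum hN hR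
  -- relabel the letters so that `d` becomes canonical
  have key : ∀ (π : Equiv.Perm (Fin 4)) (d₀ : Fin 4 ⊕ (Fin 4 × Fin 4)), (d₀ = Sum.inl 0 ∨ d₀ = Sum.inr (0, 1)) →
      permDescr π d₀ = d → False := by
    intro π d₀ hd₀ hπ
    have hid' := noise_identity_letterPerm π (T.filter fun t => S t = {0} ∨ S t = {0, 1}) X d₀ (by rw [hπ]; exact hid)
    refine psi_canonical T (fun t => letterPerm π (X t)) S (fun t ht => isSplitTerm_letterPerm π (hX t ht)) hS
      (fun v => ?_) hR d₀ hd₀ hid'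
    have := congrFun (letterPerm_permPattern π) v
    rw [← this]
    simp only [letterPerm, hsum]
  rcases d with i | ⟨i, j⟩
  · exact key (Equiv.swap 0 i) (Sum.inl 0) (Or.inl rfl) (by simp [permDescr])
  · have hij : i ≠ j := hdvalid (i, j) rfl
    obtain ⟨π, h0, h1⟩ := exists_perm_zero_one i j hij
    exact key π (Sum.inr (0, 1)) (Or.inr rfl) (by simp [permDescr, h0, h1])

end LaplaceFourLine

end Summit.ValiantsHypothesis.ValiantsHypothesis.Theorems.RigidityForcesSymmetryRankRigidMinimalRepr
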